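import Summits.CriticalPhenomena.PercolationContinuityZ3.Theorems.PercNearOneGluingNoHeavyPcintBSMTails
import Summits.CriticalPhenomena.PercolationContinuityZ3.Theorems.PercNearOneGluingNoHeavyPcintBSMFast3
import Summits.CriticalPhenomena.PercolationContinuityZ3.Theorems.PercNearOneGluingNoHeavyPcintBSMSym
import HarnessLib

/-!
# PCINT lane, PHASE 5 (block-renewal second moment): orbit reduction of the certificate for `t = 3`

Cell `prim-pcint`, seat `prim-pcint-1` (gen 14); memo `run/shared/lean/prim/pcint/T-FIBRE-ROUTE.md` §PHASE 5.

The hyperoctahedral group (generated by the coordinate transpositions `(0 1)`, `(1 2)` and the sign flip of coordinate `0`;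
`y ↦ -y` is kept as a cheap extra generator) acts on the offsets `[-2,2]^3` with 10 orbits (35 on `[-4,4]^3`:
**`BSM.boxV_of_reps`** reduces the potential-table checks).  **`BSM.certZ_of_reps`**: if the piece family is closed under the two transpositions (reindexings
`π₁, π₂, π₃` with invariant weights) and the tables are invariant, the INTEGER certificate inequalities
(`BSM.certLHSz`, with the fast count `BSM.S3`) on a list of representatives `R`, together with a decidable covering
`∀ y ∈ [-2,2]^3, ∃ w ∈ G, applyW w y ∈ R` by words `w` in the generators, give them on all of `[-2,2]^3`.
-/

namespace Summit.CriticalPhenomena.PercolationContinuityZ3.Theorems.Pcint.BSM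

open Finset

variable {np : ℕ}

/-- The generators on offsets of `ℤ^3`: `0 ↦ (y ↦ -y)`, `1 ↦` transposition `(0 1)`, `2 ↦` transposition `(1 2)`,
`3 ↦` sign flip of coordinate `0` (together they generate the hyperoctahedral group, `0` being redundant but cheap). -/
def gen3 (g : Fin 4) (y : Fin 3 → ℤ) : Fin 3 → ℤ :=
  if g = 0 then -y else if g = 1 then pv (Equiv.swap 0 1) y else if g = 2 then pv (Equiv.swap 1 2) y else negC 0 y

/-- Apply a word of generators (rightmost first). -/
def applyW (w : List (Fin 4)) (y : Fin 3 → ℤ) : Fin 3 → ℤ := w.foldr gen3 y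

/-- A function invariant under the generators is invariant under words. -/
theorem applyW_invariant' {β : Type*} (f : (Fin 3 → ℤ) → β) (h : ∀ g y, f (gen3 g y) = f y) :
    ∀ (w : List (Fin 4)) (y : Fin 3 → ℤ), f (applyW w y) = f y
  | [], _ => rfl
  | g :: w, y => by
    rw [applyW, List.foldr_cons, ← applyW, h g, applyW_invariant' f h w y]

/-- The generators, explicitly. -/
theorem gen3_apply (y : Fin 3 → ℤ) : gen3 0 y = -y ∧ gen3 1 y = pv (Equiv.swap 0 1) y ∧
    gen3 2 y = pv (Equiv.swap 1 2) y ∧ gen3 3 y = negC 0 y := by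
  unfold gen3; simp

/-- The generators are additive. -/
theorem gen3_sub (g : Fin 4) (z u : Fin 3 → ℤ) : gen3 g z - gen3 g u = gen3 g (z - u) := by
  unfold gen3; split_ifs
  · abel
  · rw [pv_sub]
  · rw [pv_sub]
  · rw [negC_sub]

/-- `canonK` is invariant under the generators. -/
theorem canonK_gen3 (g : Fin 4) (u : Fin 3 → ℤ) : canonK (gen3 g u) = canonK u := by
  unfold gen3; split_ifs
  · exact canonK_neg u
  · exact canonK_pv _ u
  · exact canonK_pv _ u
  · exact canonK_negC _ u

/-- The generators permute `[-2,2]^3`. -/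
theorem boxList2_perm_gen3 (g : Fin 4) : ((boxList 3 2).map (gen3 g)).Perm (boxList 3 2) := by
  fin_cases g <;> decide +kernel

/-- A covering by words given position-by-position along a list. -/
theorem exists_of_zip {α β : Type*} {l : List α} {wl : List β} (hlen : l.length ≤ wl.length) (P : α → β → Prop)
    (h : ∀ p ∈ l.zip wl, P p.1 p.2) : ∀ y ∈ l, ∃ w ∈ wl, P y w := by
  intro y hy
  obtain ⟨i, hi, rfl⟩ := List.getElem_of_mem hy
  have hi' : i < wl.length := lt_of_lt_of_le hi hlen
  refine ⟨wl[i], List.getElem_mem hi', ?_⟩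
  have hz : (l[i], wl[i]) ∈ l.zip wl := by
    have hlt : i < (l.zip wl).length := by rw [List.length_zip]; exact lt_min hi hi'
    have := List.getElem_mem hlt
    rwa [List.getElem_zip] at this
  exact h _ hz

/-- Splitting a flat `drop` segment of a list quantifier: `[n, n+m)` then `[k, ∞)` with `k = n + m` (flat drops keep the
kernel's list walks short; used to assemble chunked kernel checks). -/
theorem forall_drop_split {α : Type*} {l : List α} {P : α → Prop} (n m k : ℕ) (hk : n + m = k)
    (h1 : ∀ y ∈ (l.drop n).take m, P y) (h2 : ∀ y ∈ l.drop k, P y) : ∀ y ∈ l.drop n, P y := by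
  intro y hy
  rw [← List.take_append_drop m (l.drop n), List.mem_append, List.drop_drop, hk] at hy
  exact hy.elim (h1 y) (h2 y)

/-- The potential sums are invariant under the generators. -/
theorem boxSum_gen3 (Gn Φn : (Fin 3 → ℤ) → ℕ) (Tn : ℕ) (hΦ : ∀ g u, Φn (gen3 g u) = Φn u) (g : Fin 4)
    (u : Fin 3 → ℤ) :
    ((boxList 3 2).map fun z => (Gn (canonK (z - gen3 g u)) + Tn) * Φn z).sum =
      ((boxList 3 2).map fun z => (Gn (canonK (z - u)) + Tn) * Φn z).sum := by
  rw [← ((boxList2_perm_gen3 g).map (fun z => (Gn (canonK (z - gen3 g u)) + Tn) * Φn z)).sum_eq, List.map_map]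
  congr 1
  refine List.map_congr_left fun z _ => ?_
  simp only [Function.comp_apply, gen3_sub, canonK_gen3, hΦ]

/-- **Orbit reduction of the potential-table checks** (`[-4,4]^3` → representatives). -/
theorem boxV_of_reps (Gn Vn Φn : (Fin 3 → ℤ) → ℕ) (Tn c : ℕ) (hΦ : ∀ g u, Φn (gen3 g u) = Φn u)
    (hV : ∀ g u, Vn (gen3 g u) = Vn u) (R : List (Fin 3 → ℤ)) (G : List (List (Fin 4)))
    (hclos : ∀ u ∈ boxList 3 4, ∃ w ∈ G, applyW w u ∈ R)
    (hR : ∀ u ∈ R, c + ((boxList 3 2).map fun z => (Gn (canonK (z - u)) + Tn) * Φn z).sum ≤ Vn u) :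
    ∀ u ∈ boxList 3 4, c + ((boxList 3 2).map fun z => (Gn (canonK (z - u)) + Tn) * Φn z).sum ≤ Vn u := by
  intro u hu
  obtain ⟨w, _, hw⟩ := hclos u hu
  have h1 := applyW_invariant' (fun u => ((boxList 3 2).map fun z => (Gn (canonK (z - u)) + Tn) * Φn z).sum)
    (fun g u => boxSum_gen3 Gn Φn Tn hΦ g u) w u
  have h2 := applyW_invariant' Vn hV w u
  have := hR _ hw
  rw [h1, h2] at this
  exact this

/-- **Orbit reduction of the integer certificate.** -/
theorem certZ_of_reps (pc : Fin np → List (Fin 3 × Bool)) {pe : Fin np → (Fin 3 → ℤ)}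
    (hpe : ∀ σ, pe σ = pend (pc σ)) (W : Fin np → ℕ) {k : ℕ} (hk : 1 ≤ k) {B E : ℕ} (hB : 0 < B)
    (hE : ∀ σ, (pc σ).length + 1 ≤ E) (π₁ π₂ π₃ : Fin np ≃ Fin np)
    (hπ₁ : ∀ σ, pc (π₁ σ) = (pc σ).map (pq (Equiv.swap 0 1)))
    (hπ₂ : ∀ σ, pc (π₂ σ) = (pc σ).map (pq (Equiv.swap 1 2)))
    (hπ₃ : ∀ σ, pc (π₃ σ) = (pc σ).map (flipAx 0))
    (hW₁ : ∀ σ, W (π₁ σ) = W σ) (hW₂ : ∀ σ, W (π₂ σ) = W σ) (hW₃ : ∀ σ, W (π₃ σ) = W σ)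
    (V0n V1n Φn : (Fin 3 → ℤ) → ℕ) (hV0 : ∀ g u, V0n (gen3 g u) = V0n u) (hV1 : ∀ g u, V1n (gen3 g u) = V1n u)
    (hΦ : ∀ g u, Φn (gen3 g u) = Φn u) (DΦ M : ℤ) (R : List (Fin 3 → ℤ)) (G : List (List (Fin 4)))
    (hclos : ∀ y ∈ boxList 3 2, ∃ w ∈ G, applyW w y ∈ R)
    (hR : ∀ y ∈ R, certLHSz pe (S3 pc k) W k 10000 B E V0n V1n y * DΦ ≤ (Φn y : ℤ) * M) :
    ∀ y ∈ boxList 3 2, certLHSz pe (S3 pc k) W k 10000 B E V0n V1n y * DΦ ≤ (Φn y : ℤ) * M := by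
  have hV0a : ∀ u, V0n (-u) = V0n u := fun u => by rw [← (gen3_apply u).1]; exact hV0 0 u
  have hV0b : ∀ u, V0n (pv (Equiv.swap 0 1) u) = V0n u := fun u => by rw [← (gen3_apply u).2.1]; exact hV0 1 u
  have hV0c : ∀ u, V0n (pv (Equiv.swap 1 2) u) = V0n u := fun u => by rw [← (gen3_apply u).2.2.1]; exact hV0 2 u
  have hV1a : ∀ u, V1n (-u) = V1n u := fun u => by rw [← (gen3_apply u).1]; exact hV1 0 u
  have hV1b : ∀ u, V1n (pv (Equiv.swap 0 1) u) = V1n u := fun u => by rw [← (gen3_apply u).2.1]; exact hV1 1 u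
  have hV1c : ∀ u, V1n (pv (Equiv.swap 1 2) u) = V1n u := fun u => by rw [← (gen3_apply u).2.2.1]; exact hV1 2 u
  have hV0d : ∀ u, V0n (negC 0 u) = V0n u := fun u => by rw [← (gen3_apply u).2.2.2]; exact hV0 3 u
  have hV1d : ∀ u, V1n (negC 0 u) = V1n u := fun u => by rw [← (gen3_apply u).2.2.2]; exact hV1 3 u
  have hS3 : S3 pc k = S pc k := funext fun y => funext fun σ => funext fun σ' => (S_eq_S3 pc k y σ σ').symm
  rw [hS3] at hR ⊢
  set f : (Fin 3 → ℤ) → ℤ := fun y => certLHSz pe (S pc k) W k 10000 B E V0n V1n y with hf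
  -- invariance of the integer functional under the generators, via the real functional
  have hcast : ∀ z, ((f z : ℤ) : ℝ) = certLHS pc (fun σ => (W σ : ℝ) / (1 : ℕ)) k ((10000 : ℕ) / (B : ℝ))
      (fun u => (V0n u : ℝ) / (1 : ℕ)) (fun u => (V1n u : ℝ) / (1 : ℕ)) z *
        ((k : ℝ) * (B : ℝ) ^ E * ((1 : ℕ) : ℝ) ^ 2 * (1 : ℕ)) := fun z =>
    certLHSz_cast pc hpe W hk 10000 hB hE V0n V1n z Nat.one_pos Nat.one_pos
  have h0 : ∀ z, f (-z) = f z := fun z => by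
    apply Int.cast_injective (α := ℝ)
    rw [hcast, hcast, certLHS_neg pc _ k _ (fun u => by simp only [hV0a]) (fun u => by simp only [hV1a])]
  have h1 : ∀ z, f (pv (Equiv.swap 0 1) z) = f z := fun z => by
    apply Int.cast_injective (α := ℝ)
    rw [hcast, hcast, certLHS_perm pc _ k _ (Equiv.swap 0 1) π₁ hπ₁ (fun σ => by simp only [hW₁])
      (fun u => by simp only [hV0b]) (fun u => by simp only [hV1b])]
  have h2 : ∀ z, f (pv (Equiv.swap 1 2) z) = f z := fun z => by
    apply Int.cast_injective (α := ℝ)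
    rw [hcast, hcast, certLHS_perm pc _ k _ (Equiv.swap 1 2) π₂ hπ₂ (fun σ => by simp only [hW₂])
      (fun u => by simp only [hV0c]) (fun u => by simp only [hV1c])]
  have h3 : ∀ z, f (negC 0 z) = f z := fun z => by
    apply Int.cast_injective (α := ℝ)
    rw [hcast, hcast, certLHS_flip pc _ k _ 0 π₃ hπ₃ (fun σ => by simp only [hW₃])
      (fun u => by simp only [hV0d]) (fun u => by simp only [hV1d])]
  have hgen : ∀ g z, f (gen3 g z) = f z := fun g z => by
    rcases gen3_apply z with ⟨e0, e1, e2, e3⟩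
    fin_cases g
    · exact (congr_arg f e0).trans (h0 z)
    · exact (congr_arg f e1).trans (h1 z)
    · exact (congr_arg f e2).trans (h2 z)
    · exact (congr_arg f e3).trans (h3 z)
  intro y hy
  obtain ⟨w, _, hwR⟩ := hclos y hy
  have hfy : f (applyW w y) = f y := applyW_invariant' f hgen w y
  have hΦy : Φn (applyW w y) = Φn y := applyW_invariant' Φn hΦ w y
  have := hR _ hwR
  rw [← hΦy]
  rw [hf] at hfy
  simp only at hfy
  rw [← hfy]
  exact this

end Summit.CriticalPhenomena.PercolationContinuityZ3.Theorems.Pcint.BSM
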